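import Literature.NumberTheory.LFunctions.BurnolAdelicCausality
import Literature.NumberTheory.LFunctions.NymanBeurlingBaezDuarteProofs
import HarnessLib

/-!
# Burnol 2001, Thm 2.1 = Nyman's criterion (1950) — discharge of `Burnol2001_thm_2_1`

LABEL (line 1): `Literature.NumberTheory.LFunctions.Burnol2001_thm_2_1` is an RH-EQUIVALENT·PRINTED
criterion (Nyman 1950, as quoted by Burnol 2001, Thm 2.1); this file PROVES THE EQUIVALENCE
`(𝟏 ∈ N) ↔ RiemannHypothesis` AS AN EQUIVALENCE — neither side is asserted, nothing is assumed.
bears_on: LADDER-RH B-C/B-P (COLUMN 6 DBR; the Nyman–Beurling column itself is COLUMN 4's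
`NymanBeurlingTail`). WHAT THIS IS NOT: a proof or disproof of RH; a proved criterion fixes WHICH
closure statement would prove RH, it does not move RH; nothing here bears on the truth of RH.

`N` is the closed span in `L²((0,1), du)` of Nyman's functions `ρ_α(u) = {α/u} − α{1/u}`,
`0 < α < 1` (`Literature.NumberTheory.LFunctions.Burnol2001.nymanRho`).

## The proof (both directions reduce to what the tree already has)

* `⟸` (`RiemannHypothesis → 𝟏 ∈ N`). The tree PROVES Báez-Duarte's strengthening of the
  Nyman–Beurling criterion in full (`Literature.NumberTheory.LFunctions.baezDuarte_onlyIf_holds`,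
  file `NymanBeurlingBaezDuarteProofs.lean`): under RH, for every `ε > 0` some
  `f = Σ_{k<N} c_k {1/((k+1)x)}` has `‖χ − f‖_{L²(0,∞)} < ε`, `χ = 𝟙_{(0,1]}`. On `(1,∞)` one has
  `f = C/x` with `C = Σ c_k/(k+1)`, so `|C| = ‖χ − f‖_{L²(1,∞)} < ε` (the computation inside the
  tree's `riemannHypothesis_of_beurling_closure`); and on `(0,1)`,
  `Σ_k c_k ρ_{1/(k+1)} = f − C·{1/u}` (the `k = 0` term is `ρ_1 ≡ 0`, so it is dropped and `α = 1`
  never occurs), whence `‖𝟏 − Σ_k c_k ρ_{1/(k+1)}‖_{L²(0,1)} ≤ ‖χ − f‖_{L²(0,∞)} + |C|·‖{1/u}‖_{L²(0,1)}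
  < 2ε`. So Nyman's real-parameter closure statement follows from Báez-Duarte's natural one.
* `⟹` (`𝟏 ∈ N → RiemannHypothesis`), Nyman's/Beurling's elementary half exactly as printed by
  Burnol (l.322–326: "for the proof one considers the Mellin transform",
  `ρ̂_α(s) = (α − α^s) ζ(s)/s`): by the tree's `mellin_beurlingRhoTrunc_eq` (real dilation
  `k = 1/α ≥ 1`), `∫_0^1 ρ_α(u) u^{s−1} du = (α − α^s)ζ(s)/s` for `0 < Re s`, `s ≠ 1`; at a zero
  `s₀` of `ζ` with `½ < Re s₀ < 1` every `ρ_α`, hence every finite combination `f`, is Mellin-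
  orthogonal to `u^{s₀−1} ∈ L²(0,1)`, while `∫_0^1 u^{s₀−1} du = 1/s₀`; Cauchy–Schwarz gives
  `|1/s₀| ≤ ‖𝟏 − f‖₂ · ‖u^{s₀−1}‖₂ < ε M`, and `ε → 0` is absurd. Zeros with `Re s₀ < ½` are excluded
  by the functional equation (`quasiRiemannHypothesis_one_half_iff_holds`).

No new definitions, no new named facts (net debt −1).

## References
* [Burnol2001] J.-F. Burnol, *An adelic causality problem related to abelian L-functions*,
  J. Number Theory 87 (2001) 253–269 = arXiv:math/0001013v3, Thm 2.1 (TeX l.308–311) and the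
  Mellin computation l.322–326, l.359–361.
* [Nyman1950] B. Nyman, *On the one-dimensional translation group and semi-group in certain
  function spaces*, Thesis, Uppsala 1950.
* [BaezDuarte2003] L. Báez-Duarte, Rend. Lincei (9) 14 (2003) 5–11, Thm 1.1 (the tree theorem
  `baezDuarte_iff_holds`).
-/

noncomputable section

open Complex Filter MeasureTheory Set
open scoped Real Topology

namespace Literature.NumberTheory.LFunctions

namespace Burnol2001

/-! ## Nyman's `ρ_α` versus the truncated Beurling functions of the tree -/

/-- Nyman's function `ρ_α(u) = {α/u} − α{1/u}` is (Borel) measurable.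
[cite: Burnol2001, §2 (before Thm 2.1)] -/
lemma measurable_nymanRho (α : ℝ) : Measurable (nymanRho α) := by
  unfold nymanRho
  refine Complex.measurable_ofReal.comp ?_
  exact (measurable_fract.comp (measurable_const.div measurable_id)).sub
    (measurable_const.mul (measurable_fract.comp (measurable_const.div measurable_id)))

/-- On `(0,1]`, Nyman's function is a difference of truncated Beurling functions of the tree:
`𝟙_{(0,1]}·ρ_α = beurlingRhoTrunc (1/α) − α · beurlingRhoTrunc 1` (`{α/u} = {1/((1/α)u)}`).
[cite: Burnol2001, §2 before Thm 2.1; BaezDuarte2003, §1] -/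
lemma indicator_nymanRho_eq {α : ℝ} (hα : 0 < α) (u : ℝ) :
    (Ioc (0 : ℝ) 1).indicator (nymanRho α) u =
      beurlingRhoTrunc (1 / α) u - (α : ℂ) • beurlingRhoTrunc 1 u := by
  by_cases hu : u ∈ Ioc (0 : ℝ) 1
  · simp only [indicator_of_mem hu, beurlingRhoTrunc, nymanRho, smul_eq_mul]
    have h1 : 1 / (1 / α * u) = α / u := by field_simp
    rw [h1, one_mul]
    push_cast
    ring
  · simp only [indicator_of_notMem hu, beurlingRhoTrunc, smul_zero, sub_zero]

/-- **Nyman's Mellin formula** (Burnol l.359–361: `ρ̂_α(s) = (α − α^s) ζ(s)/s`): for `0 < α ≤ 1`,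
`0 < Re s`, `s ≠ 1`, `∫_0^1 ρ_α(u) u^{s−1} du = (α − α^s) ζ(s)/s`, with absolute convergence. From
the tree's `mellin_beurlingRhoTrunc_eq` at the real dilations `1/α` and `1`.
[cite: Burnol2001, §2 (Mellin transforms of the `ρ_α`)] -/
theorem hasMellin_indicator_nymanRho {α : ℝ} (hα : 0 < α) (hα1 : α ≤ 1) {s : ℂ}
    (hs : 0 < s.re) (hs1 : s ≠ 1) :
    HasMellin ((Ioc (0 : ℝ) 1).indicator (nymanRho α)) s
      (((α : ℂ) - (α : ℂ) ^ s) * riemannZeta s / s) := by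
  have hk : 1 ≤ 1 / α := by rw [le_div_iff₀ hα]; linarith
  have hfun : (Ioc (0 : ℝ) 1).indicator (nymanRho α) =
      fun u ↦ beurlingRhoTrunc (1 / α) u - (α : ℂ) • beurlingRhoTrunc 1 u :=
    funext (indicator_nymanRho_eq hα)
  rw [hfun]
  have h1 : MellinConvergent (beurlingRhoTrunc (1 / α)) s := mellinConvergent_beurlingRhoTrunc _ hs
  have h2 : MellinConvergent (fun u ↦ (α : ℂ) • beurlingRhoTrunc 1 u) s :=
    (mellinConvergent_beurlingRhoTrunc 1 hs).const_smul (α : ℂ)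
  have h := hasMellin_sub h1 h2
  refine ⟨h.1, h.2.trans ?_⟩
  rw [mellin_const_smul, mellin_beurlingRhoTrunc_eq hk hs hs1,
    mellin_beurlingRhoTrunc_eq (le_refl (1 : ℝ)) hs hs1, smul_eq_mul]
  have hs0 : s ≠ 0 := fun h0 ↦ by simp [h0] at hs
  have hs2 : s - 1 ≠ 0 := sub_ne_zero.2 hs1
  have hα0 : (α : ℂ) ≠ 0 := by exact_mod_cast hα.ne'
  have hcpow : (((1 / α : ℝ)) : ℂ) ^ (-s) = (α : ℂ) ^ s := by
    have harg : (α : ℂ).arg ≠ π := by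
      rw [arg_ofReal_of_nonneg hα.le]; exact Real.pi_ne_zero.symm
    push_cast
    rw [one_div, inv_cpow _ _ harg, cpow_neg, inv_inv]
  rw [hcpow]
  push_cast
  rw [one_cpow]
  field_simp
  ring

end Burnol2001

open Burnol2001

/-! ## `𝟏 ∈ N ⟹ RH` (Nyman's elementary half, via the Mellin transform) -/

/-- **Nyman ⟹.** If the constant function `𝟏` on `(0,1)` is an `L²((0,1))`-limit of finite
combinations of the `ρ_α`, `0 < α < 1`, then the Riemann hypothesis holds: a zero `s₀` with
`½ < Re s₀ < 1` is impossible since every `ρ_α` is Mellin-orthogonal to `u^{s₀−1}`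
(`hasMellin_indicator_nymanRho` and `ζ(s₀) = 0`) while `∫_0^1 u^{s₀−1} du = 1/s₀ ≠ 0`
(Cauchy–Schwarz, `ε → 0`); zeros left of the line are excluded by the functional equation
(`quasiRiemannHypothesis_one_half_iff_holds`). Mirrors the tree's
`riemannHypothesis_of_beurling_closure`. [cite: Burnol2001, Thm 2.1 (⟹); Nyman1950] -/
theorem riemannHypothesis_of_nyman_closure
    (h : ∀ ε : ℝ, 0 < ε → ∃ (n : ℕ) (α : Fin n → ℝ) (c : Fin n → ℂ), (∀ i, 0 < α i ∧ α i < 1) ∧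
      eLpNorm (fun u : ℝ ↦ (1 : ℂ) - ∑ i, c i * nymanRho (α i) u) 2
        (volume.restrict (Ioo (0 : ℝ) 1)) < ENNReal.ofReal ε) :
    RiemannHypothesis := by
  refine quasiRiemannHypothesis_one_half_iff_holds.1 fun s hζ hσ hσ1 ↦ ?_
  set μ0 : Measure ℝ := volume.restrict (Ioi 0) with hμ0
  have hre : 0 < s.re := by linarith
  have hs0 : s ≠ 0 := fun h0 ↦ by simp [h0] at hre
  have hs1 : s ≠ 1 := fun h1 ↦ by simp [h1] at hσ1
  -- the test function `g = 𝟙_{(0,1]} x^{s-1}` and its (finite) `L²` norm `M`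
  set g : ℝ → ℂ := (Ioc (0 : ℝ) 1).indicator fun x ↦ (x : ℂ) ^ (s - 1) with hg
  have hgm : AEStronglyMeasurable g μ0 := by
    refine (Measurable.indicator ?_ measurableSet_Ioc).aestronglyMeasurable
    exact Complex.measurable_ofReal.pow_const _
  have hgL2 : MemLp g 2 μ0 := by
    refine (memLp_two_iff_integrable_sq_norm hgm).2 ?_
    have hI : IntegrableOn (fun x : ℝ ↦ x ^ (2 * (s.re - 1))) (Ioc 0 1) μ0 :=
      (intervalIntegral.intervalIntegrable_rpow' (a := 0) (b := 1) (by linarith)).1.restrict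
    refine (hI.integrable_indicator measurableSet_Ioc).congr ?_
    filter_upwards [ae_restrict_mem measurableSet_Ioi] with x (hx : 0 < x)
    by_cases hx1 : x ∈ Ioc (0 : ℝ) 1
    · simp only [hg, indicator_of_mem hx1, norm_cpow_eq_rpow_re_of_pos hx, sub_re, one_re]
      rw [← Real.rpow_natCast, ← Real.rpow_mul hx.le]
      norm_num [mul_comm]
    · simp [hg, indicator_of_notMem hx1]
  set M : ℝ := (eLpNorm g 2 μ0).toReal with hM
  have hM0 : 0 ≤ M := ENNReal.toReal_nonneg
  -- Key estimate: for every `ε > 0`, `‖1/s‖ ≤ ε M`.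
  have key : ∀ ε : ℝ, 0 < ε → ‖(1 : ℂ) / s‖ ≤ ε * M := by
    intro ε hε
    obtain ⟨n, α, c, hα, hN⟩ := h ε hε
    set D : ℝ → ℂ := fun u ↦ (1 : ℂ) - ∑ i, c i * nymanRho (α i) u with hD
    have hDm : Measurable D :=
      measurable_const.sub (Finset.measurable_sum _ fun i _ ↦
        measurable_const.mul (measurable_nymanRho (α i)))
    set Dc : ℝ → ℂ := (Ioc (0 : ℝ) 1).indicator D with hDc
    have hDcm : Measurable Dc := hDm.indicator measurableSet_Ioc
    have hDc_eq : ∀ x : ℝ, Dc x = (Ioc (0 : ℝ) 1).indicator (fun _ ↦ (1 : ℂ)) x -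
        ∑ i, c i * (Ioc (0 : ℝ) 1).indicator (nymanRho (α i)) x := by
      intro x
      by_cases hx : x ∈ Ioc (0 : ℝ) 1
      · simp only [hDc, hD, indicator_of_mem hx]
      · simp only [hDc, indicator_of_notMem hx, mul_zero, Finset.sum_const_zero, sub_zero]
    ------------------------------------------------------------------
    -- (i) `‖Dc‖_{L²(0,∞)} = ‖D‖_{L²(0,1)} < ε`
    ------------------------------------------------------------------
    have hDc2 : eLpNorm Dc 2 μ0 < ENNReal.ofReal ε := by
      have h1 : eLpNorm Dc 2 μ0 = eLpNorm D 2 (volume.restrict (Ioo (0 : ℝ) 1)) := by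
        rw [hDc, eLpNorm_indicator_eq_eLpNorm_restrict measurableSet_Ioc, hμ0,
          Measure.restrict_restrict measurableSet_Ioc, inter_eq_left.2 Ioc_subset_Ioi_self,
          Measure.restrict_congr_set (Ioo_ae_eq_Ioc (μ := (volume : Measure ℝ)) (a := 0) (b := 1))]
      rw [h1]; exact hN
    ------------------------------------------------------------------
    -- (ii) the pairing with `x^{s-1}` on `(0,1]` equals `1/s`
    ------------------------------------------------------------------
    have hI : ∫ x in Ioi (0 : ℝ), (x : ℂ) ^ (s - 1) • Dc x = 1 / s := by
      have hlin : (fun x : ℝ ↦ (x : ℂ) ^ (s - 1) • Dc x) = fun x : ℝ ↦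
          (x : ℂ) ^ (s - 1) • (Ioc (0 : ℝ) 1).indicator (fun _ ↦ (1 : ℂ)) x -
            ∑ i, c i * ((x : ℂ) ^ (s - 1) • (Ioc (0 : ℝ) 1).indicator (nymanRho (α i)) x) := by
        funext x
        rw [hDc_eq, smul_eq_mul, smul_eq_mul, mul_sub, Finset.mul_sum]
        congr 1
        exact Finset.sum_congr rfl fun i _ ↦ by rw [smul_eq_mul]; ring
      have hint1 : Integrable (fun x : ℝ ↦ (x : ℂ) ^ (s - 1) •
          (Ioc (0 : ℝ) 1).indicator (fun _ ↦ (1 : ℂ)) x) μ0 := (hasMellin_one_Ioc hre).1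
      have hmel : ∀ i, HasMellin ((Ioc (0 : ℝ) 1).indicator (nymanRho (α i))) s 0 := by
        intro i
        have := hasMellin_indicator_nymanRho (hα i).1 (hα i).2.le hre hs1
        rw [hζ, mul_zero, zero_div] at this
        exact this
      have hint2 : ∀ i, Integrable (fun x : ℝ ↦ c i *
          ((x : ℂ) ^ (s - 1) • (Ioc (0 : ℝ) 1).indicator (nymanRho (α i)) x)) μ0 :=
        fun i ↦ (hmel i).1.const_mul _
      rw [hlin, integral_sub hint1 (integrable_finsetSum _ fun i _ ↦ hint2 i),
        integral_finsetSum _ fun i _ ↦ hint2 i]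
      have h1 : ∫ x in Ioi (0 : ℝ), (x : ℂ) ^ (s - 1) •
          (Ioc (0 : ℝ) 1).indicator (fun _ ↦ (1 : ℂ)) x = 1 / s := (hasMellin_one_Ioc hre).2
      have h2 : ∀ i, ∫ x in Ioi (0 : ℝ), (x : ℂ) ^ (s - 1) •
          (Ioc (0 : ℝ) 1).indicator (nymanRho (α i)) x = 0 := fun i ↦ (hmel i).2
      rw [h1, Finset.sum_congr rfl fun i _ ↦
        (integral_const_mul _ _).trans (congrArg (fun z ↦ c i * z) (h2 i))]
      simp
    ------------------------------------------------------------------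
    -- (iii) Cauchy–Schwarz on `(0,1]`: the pairing has norm `≤ ε M`
    ------------------------------------------------------------------
    have hIle : ‖∫ x in Ioi (0 : ℝ), (x : ℂ) ^ (s - 1) • Dc x‖ ≤ ε * M := by
      have hprod : (fun x : ℝ ↦ (x : ℂ) ^ (s - 1) • Dc x) = Dc • g := by
        funext x
        simp only [Pi.smul_apply', smul_eq_mul, hDc, hg]
        by_cases hx : x ∈ Ioc (0 : ℝ) 1
        · simp only [indicator_of_mem hx]; ring
        · simp only [indicator_of_notMem hx, mul_zero]
      have hH : eLpNorm (Dc • g) 1 μ0 ≤ ENNReal.ofReal ε * eLpNorm g 2 μ0 :=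
        (eLpNorm_smul_le_mul_eLpNorm hgm hDcm.aestronglyMeasurable).trans
          (by gcongr)
      have hfin : ENNReal.ofReal ε * eLpNorm g 2 μ0 ≠ ⊤ :=
        ENNReal.mul_ne_top ENNReal.ofReal_ne_top hgL2.eLpNorm_lt_top.ne
      calc ‖∫ x in Ioi (0 : ℝ), (x : ℂ) ^ (s - 1) • Dc x‖
          ≤ (∫⁻ x in Ioi (0 : ℝ), ENNReal.ofReal ‖(x : ℂ) ^ (s - 1) • Dc x‖).toReal :=
            norm_integral_le_lintegral_norm _
        _ = (eLpNorm (Dc • g) 1 μ0).toReal := by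
            rw [← hprod, eLpNorm_one_eq_lintegral_enorm]
            simp_rw [ofReal_norm]
            rfl
        _ ≤ (ENNReal.ofReal ε * eLpNorm g 2 μ0).toReal := ENNReal.toReal_mono hfin hH
        _ = ε * M := by rw [ENNReal.toReal_mul, ENNReal.toReal_ofReal hε.le]
    rw [← hI]
    exact hIle
  -- Conclusion: `‖1/s‖ = 0`, absurd.
  have hpos : 0 < ‖(1 : ℂ) / s‖ := norm_pos_iff.2 (one_div_ne_zero hs0)
  have := key (‖(1 : ℂ) / s‖ / (2 * (M + 1))) (by positivity)
  have hlt : ‖(1 : ℂ) / s‖ / (2 * (M + 1)) * M < ‖(1 : ℂ) / s‖ := by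
    rw [div_mul_eq_mul_div, div_lt_iff₀ (by positivity)]
    nlinarith
  linarith

/-! ## `RH ⟹ 𝟏 ∈ N` (transport of Báez-Duarte's natural approximation, a tree theorem) -/

/-- **Nyman ⟸.** Under RH, `𝟏` is an `L²((0,1))`-limit of finite combinations of the `ρ_α`,
`0 < α < 1`: Báez-Duarte's theorem (`baezDuarte_onlyIf_holds`) gives
`f = Σ_{k<N} c_k{1/((k+1)x)}` with `‖𝟙_{(0,1]} − f‖_{L²(0,∞)} < ε/3`; the tail `x > 1`, where
`f = C/x`, `C = Σ c_k/(k+1)`, forces `|C| ≤ ε/3`; and on `(0,1)`,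
`Σ_{k ≥ 1} c_k ρ_{1/(k+1)} = f − C{1/u}`, so `‖𝟏 − Σ_{k≥1} c_k ρ_{1/(k+1)}‖_{L²(0,1)} ≤ ε/3 + |C| < ε`
(`|{1/u}| ≤ 1`). [cite: Burnol2001, Thm 2.1 (⟸); BaezDuarte2003, Thm 1.1] -/
theorem nyman_closure_of_riemannHypothesis (hRH : RiemannHypothesis) :
    ∀ ε : ℝ, 0 < ε → ∃ (n : ℕ) (α : Fin n → ℝ) (c : Fin n → ℂ), (∀ i, 0 < α i ∧ α i < 1) ∧
      eLpNorm (fun u : ℝ ↦ (1 : ℂ) - ∑ i, c i * nymanRho (α i) u) 2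
        (volume.restrict (Ioo (0 : ℝ) 1)) < ENNReal.ofReal ε := by
  intro ε hε
  have hε3 : 0 < ε / 3 := by positivity
  obtain ⟨N, c, hN⟩ := baezDuarte_onlyIf_holds hRH (ε / 3) hε3
  set μ0 : Measure ℝ := volume.restrict (Ioi 0) with hμ0
  set μ1 : Measure ℝ := volume.restrict (Ioo (0 : ℝ) 1) with hμ1
  set D : ℝ → ℝ := fun x ↦ (Ioc (0 : ℝ) 1).indicator 1 x -
    ∑ k : Fin N, c k * Int.fract (1 / (((k : ℕ) + 1 : ℝ) * x)) with hD
  have hDm : Measurable D := by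
    refine (measurable_one.indicator measurableSet_Ioc).sub (Finset.measurable_sum _ fun k _ ↦ ?_)
    exact measurable_const.mul (measurable_fract.comp (by fun_prop))
  set C : ℝ := ∑ k : Fin N, c k / ((k : ℕ) + 1) with hC
  ------------------------------------------------------------------
  -- (i) the tail `x > 1` gives `|C| ≤ ε/3` (as in `riemannHypothesis_of_beurling_closure`)
  ------------------------------------------------------------------
  have hDtail : ∀ x : ℝ, 1 < x → D x = -C * x⁻¹ := by
    intro x hx
    have hx0 : 0 < x := by linarith
    have hxm : x ∉ Ioc (0 : ℝ) 1 := fun h' ↦ absurd h'.2 (not_le.2 hx)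
    simp only [hD, indicator_of_notMem hxm, zero_sub, hC, neg_mul, Finset.sum_mul, neg_inj]
    refine Finset.sum_congr rfl fun k _ ↦ ?_
    have hk : (0 : ℝ) < (k : ℕ) + 1 := by positivity
    rw [Int.fract_eq_self.2 ⟨by positivity, ?_⟩]
    · field_simp
    · rw [div_lt_one (by positivity)]; nlinarith
  have hCε : |C| ≤ ε / 3 := by
    have h1 : eLpNorm D 2 (volume.restrict (Ioi 1)) < ENNReal.ofReal (ε / 3) :=
      (eLpNorm_mono_measure D (Measure.restrict_mono_set _ (Ioi_subset_Ioi zero_le_one))).trans_lt hN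
    have h2 : eLpNorm D 2 (volume.restrict (Ioi 1)) =
        eLpNorm ((-C) • fun x : ℝ ↦ x⁻¹) 2 (volume.restrict (Ioi 1)) := by
      refine eLpNorm_congr_ae ?_
      filter_upwards [ae_restrict_mem measurableSet_Ioi] with x hx
      rw [hDtail x hx, Pi.smul_apply, smul_eq_mul]
    rw [h2, eLpNorm_const_smul, eLpNorm_inv_Ioi_one, mul_one, enorm_neg,
      Real.enorm_eq_ofReal_abs, ENNReal.ofReal_lt_ofReal_iff hε3] at h1
    exact h1.le
  ------------------------------------------------------------------
  -- (ii) the Nyman data: `α_k = 1/(k+1)` with coefficient `c_k` for `k ≥ 1`; the `k = 0` slot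
  -- (which would be `α = 1`, `ρ_1 ≡ 0`) carries `α = 1/2` with coefficient `0`.
  ------------------------------------------------------------------
  refine ⟨N, fun k ↦ if (k : ℕ) = 0 then 1 / 2 else 1 / ((k : ℕ) + 1 : ℝ),
    fun k ↦ if (k : ℕ) = 0 then 0 else (c k : ℂ), ?_, ?_⟩
  · intro i
    by_cases hi : (i : ℕ) = 0
    · simp only [hi, if_true]; norm_num
    · simp only [hi, if_false]
      have hi1 : (1 : ℝ) ≤ (i : ℕ) := by exact_mod_cast Nat.one_le_iff_ne_zero.2 hi
      constructor
      · positivity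
      · rw [div_lt_one (by positivity)]; linarith
  -- pointwise identity on `(0,1)`: `𝟏 − Σ c'_k ρ_{α_k} = D + C·{1/u}`
  have hpt : ∀ x ∈ Ioo (0 : ℝ) 1,
      (1 : ℂ) - ∑ i : Fin N, (if (i : ℕ) = 0 then (0 : ℂ) else (c i : ℂ)) *
          nymanRho (if (i : ℕ) = 0 then 1 / 2 else 1 / ((i : ℕ) + 1 : ℝ)) x =
        (D x : ℂ) + (C : ℂ) * ((Int.fract (1 / x) : ℝ) : ℂ) := by
    intro x hx
    have hx1 : x ∈ Ioc (0 : ℝ) 1 := ⟨hx.1, hx.2.le⟩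
    simp only [hD, hC, indicator_of_mem hx1, Pi.one_apply]
    push_cast
    rw [Finset.sum_mul, sub_add, ← Finset.sum_sub_distrib]
    congr 1
    refine Finset.sum_congr rfl fun i _ ↦ ?_
    by_cases hi : (i : ℕ) = 0
    · simp [hi]
    · simp only [hi, if_false, nymanRho]
      rw [div_div]
      push_cast
      ring
  have hcongr : eLpNorm (fun u : ℝ ↦ (1 : ℂ) - ∑ i : Fin N,
        (if (i : ℕ) = 0 then (0 : ℂ) else (c i : ℂ)) *
          nymanRho (if (i : ℕ) = 0 then 1 / 2 else 1 / ((i : ℕ) + 1 : ℝ)) u) 2 μ1 =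
      eLpNorm (fun x : ℝ ↦ (D x : ℂ) + (C : ℂ) * ((Int.fract (1 / x) : ℝ) : ℂ)) 2 μ1 := by
    refine eLpNorm_congr_ae ?_
    filter_upwards [ae_restrict_mem measurableSet_Ioo] with x hx
    exact hpt x hx
  rw [hcongr]
  -- the two pieces
  have hDcm : AEStronglyMeasurable (fun x : ℝ ↦ (D x : ℂ)) μ1 :=
    (Complex.measurable_ofReal.comp hDm).aestronglyMeasurable
  have hFm : AEStronglyMeasurable (fun x : ℝ ↦ (C : ℂ) * ((Int.fract (1 / x) : ℝ) : ℂ)) μ1 := by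
    refine (measurable_const.mul ?_).aestronglyMeasurable
    exact Complex.measurable_ofReal.comp (measurable_fract.comp (measurable_const.div measurable_id))
  have hD1 : eLpNorm (fun x : ℝ ↦ (D x : ℂ)) 2 μ1 < ENNReal.ofReal (ε / 3) := by
    have h1 : eLpNorm (fun x : ℝ ↦ (D x : ℂ)) 2 μ1 = eLpNorm D 2 μ1 :=
      eLpNorm_congr_norm_ae (Eventually.of_forall fun x ↦ by rw [Complex.norm_real])
    rw [h1]
    exact (eLpNorm_mono_measure D (Measure.restrict_mono_set _ Ioo_subset_Ioi_self)).trans_lt hN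
  have hF1 : eLpNorm (fun x : ℝ ↦ (C : ℂ) * ((Int.fract (1 / x) : ℝ) : ℂ)) 2 μ1 ≤
      ENNReal.ofReal (ε / 3) := by
    have h1 : eLpNorm (fun x : ℝ ↦ (C : ℂ) * ((Int.fract (1 / x) : ℝ) : ℂ)) 2 μ1 =
        ‖(C : ℂ)‖ₑ * eLpNorm (fun x : ℝ ↦ ((Int.fract (1 / x) : ℝ) : ℂ)) 2 μ1 := by
      rw [← eLpNorm_const_smul]; rfl
    have h2 : eLpNorm (fun x : ℝ ↦ ((Int.fract (1 / x) : ℝ) : ℂ)) 2 μ1 ≤ 1 := by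
      refine (eLpNorm_le_of_ae_bound (C := 1) (Eventually.of_forall fun x ↦ ?_)).trans ?_
      · rw [Complex.norm_real, Real.norm_eq_abs, abs_of_nonneg (Int.fract_nonneg _)]
        exact (Int.fract_lt_one _).le
      · rw [hμ1, Measure.restrict_apply_univ, Real.volume_Ioo]
        simp
    rw [h1]
    calc ‖(C : ℂ)‖ₑ * eLpNorm (fun x : ℝ ↦ ((Int.fract (1 / x) : ℝ) : ℂ)) 2 μ1
        ≤ ‖(C : ℂ)‖ₑ * 1 := by gcongr
      _ = ENNReal.ofReal |C| := by
          rw [mul_one, ← ofReal_norm, Complex.norm_real, Real.norm_eq_abs]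
      _ ≤ ENNReal.ofReal (ε / 3) := ENNReal.ofReal_le_ofReal hCε
  calc eLpNorm (fun x : ℝ ↦ (D x : ℂ) + (C : ℂ) * ((Int.fract (1 / x) : ℝ) : ℂ)) 2 μ1
      ≤ eLpNorm (fun x : ℝ ↦ (D x : ℂ)) 2 μ1 +
          eLpNorm (fun x : ℝ ↦ (C : ℂ) * ((Int.fract (1 / x) : ℝ) : ℂ)) 2 μ1 :=
        eLpNorm_add_le hDcm hFm (by norm_num)
    _ < ENNReal.ofReal (ε / 3) + ENNReal.ofReal (ε / 3) :=
        ENNReal.add_lt_add_of_lt_of_le (ne_top_of_le_ne_top ENNReal.ofReal_ne_top hF1) hD1 hF1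
    _ ≤ ENNReal.ofReal ε := by
        rw [← ENNReal.ofReal_add hε3.le hε3.le]
        exact ENNReal.ofReal_le_ofReal (by linarith)

/-! ## The discharge -/

/-- **Burnol 2001, Thm 2.1 = Nyman's criterion (1950)**, discharge of the named fact
`Literature.NumberTheory.LFunctions.Burnol2001_thm_2_1`: the constant function `𝟏` on `(0,1)`
belongs to the closed span `N` of the `ρ_α`, `0 < α < 1`, in `L²((0,1), du)` if and only if the
Riemann hypothesis holds. PROVED AS AN EQUIVALENCE (neither side asserted).
[cite: Burnol2001, Thm 2.1 (arXiv v3 l.308–311); Nyman1950; BaezDuarte2003, Thm 1.1] -/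
theorem Burnol2001_thm_2_1_holds : Burnol2001_thm_2_1 :=
  ⟨riemannHypothesis_of_nyman_closure, nyman_closure_of_riemannHypothesis⟩

end Literature.NumberTheory.LFunctions

end
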